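import Summits.RiemannHypothesis.RiemannHypothesis.Theorems.WeilFormatCWindowLimit
import HarnessLib

/-!
# Format C: continuity of the window form along ALMOST-EVERYWHERE convergent, DOMINATED window families

Helper file (`--supports stmt-RiemannHypothesis-0098`, lead-track anchor), RH-free, no definitions, no named
facts. Seat rh-explicit-weil-3 (gen3). `WeilFormatCWindowLimit.lean` proves `tendsto_weilWindowForm_of_uniform`
for UNIFORMLY convergent, `N`-uniformly Lipschitz window families (truncated Fourier series). The converse of the
dictionary ("positivity on `C(a)` ⟹ positivity of the window form on `K(a)` ⊇ trigonometric windows", i.e.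
COMPLETENESS of format C, `WeilFormatCWindowClosure.lean`) approximates a window function with JUMPS at `±a` by
smooth cut-offs `u·η_k ∈ C(a)`: convergence is only almost everywhere and the Lipschitz constants blow up, so the
archimedean energy needs an externally supplied majorant. This file is that variant of the limit machinery:

* `tendsto_integral_norm_sq_of_ae_tendsto`, `tendsto_integral_mul_of_ae_tendsto`, `tendsto_weilPoleForm_of_ae_tendsto`,
  `tendsto_weilIncrement_of_ae_tendsto`: `‖·‖₂²`, moments, the pole form and every increment `D_t` converge along
  window families (`u_N` measurable, vanishing off `[−a, a]`, `‖u_N‖ ≤ S₀`) converging to `φ` almost everywhere;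
* `tendsto_archIntegral_of_le`: the archimedean energy `∫₀^∞ weilArchDensity·D_t(u_N)` converges as soon as
  `D_t(u_N) ≤ m(t)` with `weilArchDensity·m` integrable on `(0, ∞)` and `D_t(u_N) → D_t(φ)` for `t > 0`;
* `tendsto_weilWindowForm_of_ae_tendsto_of_le`: hence `weilWindowForm b (u_N) → weilWindowForm b φ`.
-/

set_option autoImplicit false
set_option linter.dupNamespace false  -- the mandated namespace repeats `RiemannHypothesis`

noncomputable section

open Complex Filter Set MeasureTheory
open scoped Real Topology ComplexConjugate ArithmeticFunction.vonMangoldt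

namespace Summit.RiemannHypothesis.RiemannHypothesis.Theorems.WeilFormatC

open Literature.NumberTheory.LFunctions

variable {a : ℝ} {φ : ℝ → ℂ} {u : ℕ → ℝ → ℂ} {S₀ : ℝ}

/-- `∫ ‖u_N‖² → ∫ ‖φ‖²` along an a.e.-convergent bounded window family. -/
theorem tendsto_integral_norm_sq_of_ae_tendsto (hum : ∀ N, Measurable (u N))
    (huz : ∀ N x, x ∉ Icc (-a) a → u N x = 0) (hub : ∀ N x, ‖u N x‖ ≤ S₀)
    (hpt : ∀ᵐ x : ℝ, Tendsto (fun N ↦ u N x) atTop (𝓝 (φ x))) :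
    Tendsto (fun N ↦ ∫ x : ℝ, ‖u N x‖ ^ 2) atTop (𝓝 (∫ x : ℝ, ‖φ x‖ ^ 2)) := by
  have hS₀ : 0 ≤ S₀ := (norm_nonneg _).trans (hub 0 0)
  refine tendsto_integral_of_dominated_convergence
    (fun x ↦ S₀ ^ 2 * (Icc (-a) a).indicator 1 x)
    (fun N ↦ ((hum N).norm.pow_const 2).aestronglyMeasurable) ?_
    (fun N ↦ Eventually.of_forall fun x ↦ ?_) (hpt.mono fun x hx ↦ (hx.norm).pow 2)
  · exact ((integrable_indicator_iff measurableSet_Icc).2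
      (integrableOn_const (by simp [Real.volume_Icc]))).const_mul _
  · rw [Real.norm_of_nonneg (by positivity)]
    by_cases hx : x ∈ Icc (-a) a
    · rw [indicator_of_mem hx, Pi.one_apply, mul_one]
      have := hub N x
      have h0 : 0 ≤ ‖u N x‖ := norm_nonneg _
      nlinarith
    · rw [huz N x hx, indicator_of_notMem hx, norm_zero, mul_zero]
      simp

/-- Moments `∫ u_N·w → ∫ φ·w` against a continuous weight along an a.e.-convergent bounded window family. -/
theorem tendsto_integral_mul_of_ae_tendsto {w : ℝ → ℂ} (hw : Continuous w)
    (hum : ∀ N, Measurable (u N)) (huz : ∀ N x, x ∉ Icc (-a) a → u N x = 0)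
    (hub : ∀ N x, ‖u N x‖ ≤ S₀) (hpt : ∀ᵐ x : ℝ, Tendsto (fun N ↦ u N x) atTop (𝓝 (φ x))) :
    Tendsto (fun N ↦ ∫ x : ℝ, u N x * w x) atTop (𝓝 (∫ x : ℝ, φ x * w x)) := by
  refine tendsto_integral_of_dominated_convergence
    (fun x ↦ (Icc (-a) a).indicator (fun x ↦ S₀ * ‖w x‖) x)
    (fun N ↦ ((hum N).mul hw.measurable).aestronglyMeasurable) ?_
    (fun N ↦ Eventually.of_forall fun x ↦ ?_) (hpt.mono fun x hx ↦ hx.mul tendsto_const_nhds)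
  · exact (integrable_indicator_iff measurableSet_Icc).2
      ((continuous_const.mul hw.norm).continuousOn.integrableOn_Icc)
  · by_cases hx : x ∈ Icc (-a) a
    · rw [indicator_of_mem hx, norm_mul]
      exact mul_le_mul_of_nonneg_right (hub N x) (norm_nonneg _)
    · rw [huz N x hx, indicator_of_notMem hx, zero_mul, norm_zero]

/-- The pole form converges along an a.e.-convergent bounded window family. -/
theorem tendsto_weilPoleForm_of_ae_tendsto (hum : ∀ N, Measurable (u N))
    (huz : ∀ N x, x ∉ Icc (-a) a → u N x = 0) (hub : ∀ N x, ‖u N x‖ ≤ S₀)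
    (hpt : ∀ᵐ x : ℝ, Tendsto (fun N ↦ u N x) atTop (𝓝 (φ x))) :
    Tendsto (fun N ↦ weilPoleForm (u N)) atTop (𝓝 (weilPoleForm φ)) := by
  unfold weilPoleForm
  have hc : Continuous fun x : ℝ ↦ ((Real.cosh (x / 2) : ℝ) : ℂ) :=
    Complex.continuous_ofReal.comp (Real.continuous_cosh.comp (continuous_id.div_const 2))
  have hs : Continuous fun x : ℝ ↦ ((Real.sinh (x / 2) : ℝ) : ℂ) :=
    Complex.continuous_ofReal.comp (Real.continuous_sinh.comp (continuous_id.div_const 2))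
  have h1 := tendsto_integral_mul_of_ae_tendsto hc hum huz hub hpt
  have h2 := tendsto_integral_mul_of_ae_tendsto hs hum huz hub hpt
  exact ((h1.norm.pow 2).const_mul 2).sub ((h2.norm.pow 2).const_mul 2)

/-- Almost-everywhere statements are invariant under translation of the real line. -/
theorem ae_comp_add_right {p : ℝ → Prop} (h : ∀ᵐ x : ℝ, p x) (t : ℝ) : ∀ᵐ x : ℝ, p (x + t) := by
  rw [ae_iff] at h ⊢
  have : {x : ℝ | ¬p (x + t)} = (fun x ↦ x + t) ⁻¹' {y | ¬p y} := rfl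
  rw [this, measure_preimage_add_right]
  exact h

/-- Every increment `D_t(u_N) → D_t(φ)` along an a.e.-convergent bounded window family. -/
theorem tendsto_weilIncrement_of_ae_tendsto (hum : ∀ N, Measurable (u N))
    (huz : ∀ N x, x ∉ Icc (-a) a → u N x = 0) (hub : ∀ N x, ‖u N x‖ ≤ S₀)
    (hpt : ∀ᵐ x : ℝ, Tendsto (fun N ↦ u N x) atTop (𝓝 (φ x))) (t : ℝ) :
    Tendsto (fun N ↦ weilIncrement (u N) t) atTop (𝓝 (weilIncrement φ t)) := by
  have hS₀ : 0 ≤ S₀ := (norm_nonneg _).trans (hub 0 0)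
  have hpt' : ∀ᵐ x : ℝ, Tendsto (fun N ↦ u N (x + t)) atTop (𝓝 (φ (x + t))) :=
    ae_comp_add_right hpt t
  unfold weilIncrement
  refine tendsto_integral_of_dominated_convergence
    (fun x ↦ 2 * S₀ ^ 2 * ((Icc (-a) a).indicator 1 (x + t) + (Icc (-a) a).indicator 1 x))
    (fun N ↦ ((((hum N).comp (measurable_id.add_const t)).sub (hum N)).norm.pow_const 2
      |>.aestronglyMeasurable)) ?_ (fun N ↦ Eventually.of_forall fun x ↦ ?_)
    ((hpt'.and hpt).mono fun x hx ↦ ((hx.1.sub hx.2).norm).pow 2)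
  · refine Integrable.const_mul (Integrable.add ?_ ?_) _
    · exact ((integrable_indicator_iff measurableSet_Icc).2
        (integrableOn_const (by simp [Real.volume_Icc]))).comp_add_right t
    · exact (integrable_indicator_iff measurableSet_Icc).2 (integrableOn_const (by simp [Real.volume_Icc]))
  · rw [Real.norm_of_nonneg (by positivity)]
    exact norm_sub_sq_le_window_bound' (huz N) (hub N) t x

/-- **The archimedean energy converges under an external majorant.** If `D_t(u_N) ≤ m(t)` for `t > 0` with
`weilArchDensity·m` integrable on `(0,∞)` and `D_t(u_N) → D_t(φ)` for every `t > 0`, then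
`∫₀^∞ weilArchDensity·D_t(u_N) → ∫₀^∞ weilArchDensity·D_t(φ)`. -/
theorem tendsto_archIntegral_of_le (hum : ∀ N, Measurable (u N)) {m : ℝ → ℝ}
    (hm : IntegrableOn (fun t ↦ weilArchDensity t * m t) (Ioi 0))
    (hdom : ∀ N t, 0 < t → weilIncrement (u N) t ≤ m t)
    (hinc : ∀ t, 0 < t → Tendsto (fun N ↦ weilIncrement (u N) t) atTop (𝓝 (weilIncrement φ t))) :
    Tendsto (fun N ↦ ∫ t in Ioi (0 : ℝ), weilArchDensity t * weilIncrement (u N) t) atTop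
      (𝓝 (∫ t in Ioi (0 : ℝ), weilArchDensity t * weilIncrement φ t)) := by
  refine tendsto_integral_of_dominated_convergence (fun t ↦ weilArchDensity t * m t)
    (fun N ↦ (measurable_weilArchDensity.mul (measurable_weilIncrement (hum N))).aestronglyMeasurable)
    hm (fun N ↦ ?_) ?_
  · refine (ae_restrict_iff' measurableSet_Ioi).2 (Eventually.of_forall fun t ht ↦ ?_)
    rw [Real.norm_of_nonneg (mul_nonneg (weilArchDensity_pos ht).le (weilIncrement_nonneg _ _))]
    exact mul_le_mul_of_nonneg_left (hdom N t ht) (weilArchDensity_pos ht).le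
  · exact (ae_restrict_iff' measurableSet_Ioi).2
      (Eventually.of_forall fun t ht ↦ (hinc t ht).const_mul _)

/-- **The window form converges along an a.e.-convergent bounded window family with an archimedean
majorant**: `weilWindowForm b (u_N) → weilWindowForm b φ` (any window parameter `b`). -/
theorem tendsto_weilWindowForm_of_ae_tendsto_of_le (hum : ∀ N, Measurable (u N))
    (huz : ∀ N x, x ∉ Icc (-a) a → u N x = 0) (hub : ∀ N x, ‖u N x‖ ≤ S₀)
    (hpt : ∀ᵐ x : ℝ, Tendsto (fun N ↦ u N x) atTop (𝓝 (φ x))) {m : ℝ → ℝ}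
    (hm : IntegrableOn (fun t ↦ weilArchDensity t * m t) (Ioi 0))
    (hdom : ∀ N t, 0 < t → weilIncrement (u N) t ≤ m t) (b : ℝ) :
    Tendsto (fun N ↦ weilWindowForm b (u N)) atTop (𝓝 (weilWindowForm b φ)) := by
  have hinc : ∀ t, Tendsto (fun N ↦ weilIncrement (u N) t) atTop (𝓝 (weilIncrement φ t)) :=
    tendsto_weilIncrement_of_ae_tendsto hum huz hub hpt
  have harch := tendsto_archIntegral_of_le hum hm hdom fun t _ ↦ hinc t
  have hprime : Tendsto (fun N ↦ ∑ n ∈ weilPrimeIndex b,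
      (Λ n : ℝ) / Real.sqrt n * weilIncrement (u N) (Real.log n)) atTop
      (𝓝 (∑ n ∈ weilPrimeIndex b, (Λ n : ℝ) / Real.sqrt n * weilIncrement φ (Real.log n))) :=
    tendsto_finsetSum _ fun n _ ↦ (hinc _).const_mul _
  have hpole := tendsto_weilPoleForm_of_ae_tendsto hum huz hub hpt
  have hnorm := tendsto_integral_norm_sq_of_ae_tendsto hum huz hub hpt
  unfold weilWindowForm weilDirichletEnergy
  exact (hpole.add (hprime.add harch)).sub (hnorm.const_mul _)

end Summit.RiemannHypothesis.RiemannHypothesis.Theorems.WeilFormatC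

end
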